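import Literature.AlgebraicGeometry.Motives.HodgeLieWeightOneRaisingCentralizer
import HarnessLib

/-!
# Weight one: in a simple `Lie Hg ⊗ ℂ` every Levi element is a sum of brackets `[x, z]` of raising `x` and lowering `z`
# (`𝔥⁺ + 𝔥⁻ + [𝔥⁺, 𝔥⁻]` is an ideal; Deligne I §3, Moonen–Zarhin 1999 (2.3))

Family `hodge`, layer `Literature/AlgebraicGeometry/Motives`; THEOREMS ONLY (no definition, no named fact; D-0026).  Written for the
cell `pub-hodgeav-hg6` (LADDER-HodgeAV row 2, TABLE X row 1 `g6.I(1)`: brick N15 of the row-1 programme; honest framing: HC / HC_AV /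
HC_CM NOT proved — unconditional Hodge–Lie linear algebra).

WHY.  In the residual rank-twelve crux (`RankTwelveLeviCoreCrux`: a proper Levi involution algebra of type `3|3` or `2|4` inside a
SIMPLE `𝔥_ℂ`) every argument on `V^{1,0}` works with the Levi algebra `𝔥⁰ = {Z ∈ 𝔥_ℂ : Z V^{1,0} ⊆ V^{1,0}, Z V^{0,1} ⊆ V^{0,1}}`;
simplicity makes `𝔥⁰` COMPUTABLE from the raising space: `𝔥⁰ = span{[x, z] : x raising, z lowering}` (this file).  E.g. for a minimal
tripotent of rank `4` in `dim V^{1,0} = 6` with a one-dimensional Peirce-`1` space `ℂy`, `𝔥⁰|_{V^{1,0}}` is spanned by the four operators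
`[B, B̄], [B, ȳ], [y, B̄], [y, ȳ]`, all of which preserve the plane `(E y)(V^{0,1})` (N10 §1, N14), contradicting Levi irreducibility.

* **`levi_mem_span_bracket_of_simple`** — `H` effective polarized of weight `1`, `𝔥_ℂ` simple (every non-zero `ad`-stable subspace is
  `𝔥_ℂ`), some non-zero raising operator exists.  Then every `Z ∈ 𝔥_ℂ` preserving `V^{1,0}` and `V^{0,1}` lies in the span of the
  brackets `x z − z x` with `x ∈ 𝔥_ℂ` raising and `z ∈ 𝔥_ℂ` lowering.  PROOF: `S = 𝔥⁺ + 𝔥⁻ + span[𝔥⁺, 𝔥⁻]` is `ad 𝔥_ℂ`-stable (degree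
  bookkeeping with `Y = Y⁻ + Y⁰ + Y⁺`, `SymplecticTheta.exists_decomp`, and the Jacobi identity), non-zero, hence all of `𝔥_ℂ`; the
  three summands take values in `Hom(Q, P)`, `Hom(P, Q)` and the Levi block, so a Levi element has no `𝔥^±` components.

## References

* [Deligne1982HodgeCycles] P. Deligne, *Hodge cycles on abelian varieties*, LNM 900 (1982), I §3 (proof of Prop. 3.4).
* [MoonenZarhin1999LowDim] B. Moonen, Yu. Zarhin, *Hodge classes on abelian varieties of low dimension*, Math. Ann. 315 (1999),
  §2 (2.3).
-/

noncomputable section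

open scoped TensorProduct

namespace Literature.AlgebraicGeometry.Motives

namespace HodgeStructure

universe u

variable {V : Type u} [AddCommGroup V] [Module ℚ V] [Module.Finite ℚ V] [HodgeTensorFacts.{u, u}] {n : ℤ}

set_option maxHeartbeats 3200000 in
/-- **In a simple `𝔥_ℂ` the Levi algebra is spanned by the brackets of raising and lowering operators.**
[cite: Deligne1982HodgeCycles, I §3 (proof of Prop. 3.4)] [cite: MoonenZarhin1999LowDim, §2 (2.3)] -/
theorem levi_mem_span_bracket_of_simple (H : HodgeStructure V n) (ψ : H.Polarization) (hn : n = 1) (heff : H.IsEffective)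
    (hsimple : ∀ T : Submodule ℂ (Module.End ℂ (ℂ ⊗[ℚ] V)), T ≤ H.hodgeLieC → T ≠ ⊥ →
      (∀ Y ∈ H.hodgeLieC, ∀ t ∈ T, Y * t - t * Y ∈ T) → T = H.hodgeLieC)
    {B : Module.End ℂ (ℂ ⊗[ℚ] V)} (hB : B ∈ H.hodgeLieC) (hB0 : B ≠ 0) (hBP : ∀ p ∈ H.piece 1 0, B p = 0)
    (hBim : ∀ v, B v ∈ H.piece 1 0)
    {Z : Module.End ℂ (ℂ ⊗[ℚ] V)} (hZ : Z ∈ H.hodgeLieC) (hZP : ∀ p ∈ H.piece 1 0, Z p ∈ H.piece 1 0)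
    (hZQ : ∀ q ∈ H.piece 0 1, Z q ∈ H.piece 0 1) :
    Z ∈ Submodule.span ℂ {W : Module.End ℂ (ℂ ⊗[ℚ] V) | ∃ x ∈ H.hodgeLieC, ∃ z ∈ H.hodgeLieC,
      (∀ p ∈ H.piece 1 0, x p = 0) ∧ (∀ v, x v ∈ H.piece 1 0) ∧ (∀ q ∈ H.piece 0 1, z q = 0) ∧ (∀ v, z v ∈ H.piece 0 1) ∧
      W = x * z - z * x} := by
  classical
  obtain ⟨hbr, -, -, Θ, hΘ, hΘ𝔤⟩ := hodgeLie_standing H ψ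
  have hspan : H.hodgeLieC = spanC H.hodgeLie := hodgeLieC_eq_spanC H
  have hΘC : Θ ∈ H.hodgeLieC := by rw [hspan]; exact hΘ𝔤
  have hbrC : ∀ Y ∈ H.hodgeLieC, ∀ Y' ∈ H.hodgeLieC, Y * Y' - Y' * Y ∈ H.hodgeLieC := fun Y hY Y' hY' => by
    rw [hspan] at hY hY' ⊢
    exact commutator_mem_spanC hbr hY hY'
  subst hn
  obtain ⟨hPmem, hQmem, hΘ10, hΘ01, hΘΘ⟩ := UnitaryTheta.theta_facts H rfl heff hΘ
  set P := H.piece 1 0 with hPdef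
  set Q := H.piece 0 1 with hQdef
  set M := ℂ ⊗[ℚ] V
  have hPQv : ∀ v : M, (2 : ℂ)⁻¹ • (v + Θ v) + (2 : ℂ)⁻¹ • (v - Θ v) = v := fun v => by module
  have hPQ0 : ∀ x, x ∈ P → x ∈ Q → x = 0 := fun x hP hQ => by
    have h1 := hΘ10 x hP
    rw [hΘ01 x hQ, neg_eq_iff_add_eq_zero, ← two_smul ℂ x, smul_eq_zero] at h1
    exact h1.resolve_left (two_ne_zero' ℂ)
  have hdec := fun Y (hY : Y ∈ H.hodgeLieC) => SymplecticTheta.exists_decomp H.hodgeLieC hbrC hΘC hΘΘ hΘ10 hΘ01 hPmem hQmem hY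
  -- the predicates «raising», «lowering», «Levi»
  -- basic products
  have hRR : ∀ x x' : Module.End ℂ M, (∀ p ∈ P, x p = 0) → (∀ v, x' v ∈ P) → x * x' = 0 := fun x x' hxP hx'im =>
    LinearMap.ext fun v => by rw [Module.End.mul_apply, hxP _ (hx'im v), LinearMap.zero_apply]
  have hLL : ∀ z z' : Module.End ℂ M, (∀ q ∈ Q, z q = 0) → (∀ v, z' v ∈ Q) → z * z' = 0 := fun z z' hzQ hz'im =>
    LinearMap.ext fun v => by rw [Module.End.mul_apply, hzQ _ (hz'im v), LinearMap.zero_apply]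
  have hLR : ∀ L x : Module.End ℂ M, (∀ p ∈ P, L p ∈ P) → (∀ p ∈ P, x p = 0) → (∀ v, x v ∈ P) →
      (∀ p ∈ P, (L * x - x * L) p = 0) ∧ (∀ v, (L * x - x * L) v ∈ P) := fun L x hLP hxP hxim =>
    ⟨fun p hp => by rw [LinearMap.sub_apply, Module.End.mul_apply, Module.End.mul_apply, hxP p hp, map_zero, hxP _ (hLP p hp),
      sub_zero], fun v => Submodule.sub_mem _ (hLP _ (hxim v)) (hxim _)⟩
  have hLLw : ∀ L z : Module.End ℂ M, (∀ q ∈ Q, L q ∈ Q) → (∀ q ∈ Q, z q = 0) → (∀ v, z v ∈ Q) →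
      (∀ q ∈ Q, (L * z - z * L) q = 0) ∧ (∀ v, (L * z - z * L) v ∈ Q) := fun L z hLQ hzQ hzim =>
    ⟨fun q hq => by rw [LinearMap.sub_apply, Module.End.mul_apply, Module.End.mul_apply, hzQ q hq, map_zero, hzQ _ (hLQ q hq),
      sub_zero], fun v => Submodule.sub_mem _ (hLQ _ (hzim v)) (hzim _)⟩
  have hRLw : ∀ x z : Module.End ℂ M, (∀ p ∈ P, x p = 0) → (∀ v, x v ∈ P) → (∀ q ∈ Q, z q = 0) → (∀ v, z v ∈ Q) →
      (∀ p ∈ P, (x * z - z * x) p ∈ P) ∧ (∀ q ∈ Q, (x * z - z * x) q ∈ Q) := fun x z hxP hxim hzQ hzim =>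
    ⟨fun p hp => by
      rw [LinearMap.sub_apply, Module.End.mul_apply, Module.End.mul_apply, hxP p hp, map_zero, sub_zero]; exact hxim _,
     fun q hq => by
      rw [LinearMap.sub_apply, Module.End.mul_apply, Module.End.mul_apply, hzQ q hq, map_zero, zero_sub]
      exact Submodule.neg_mem _ (hzim _)⟩
  -- the subspaces `R` (raising), `Lw` (lowering), and the generating set of brackets
  obtain ⟨R, hR⟩ : ∃ R : Submodule ℂ (Module.End ℂ M), ∀ x, x ∈ R ↔ x ∈ H.hodgeLieC ∧ (∀ p ∈ P, x p = 0) ∧ (∀ v, x v ∈ P) := by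
    refine ⟨{ carrier := {x | x ∈ H.hodgeLieC ∧ (∀ p ∈ P, x p = 0) ∧ (∀ v, x v ∈ P)}
              zero_mem' := ⟨Submodule.zero_mem _, fun p _ => rfl, fun v => Submodule.zero_mem _⟩
              add_mem' := fun {a b} ha hb => ⟨Submodule.add_mem _ ha.1 hb.1,
                fun p hp => by rw [LinearMap.add_apply, ha.2.1 p hp, hb.2.1 p hp, add_zero],
                fun v => Submodule.add_mem _ (ha.2.2 v) (hb.2.2 v)⟩
              smul_mem' := fun c a ha => ⟨Submodule.smul_mem _ _ ha.1,
                fun p hp => by rw [LinearMap.smul_apply, ha.2.1 p hp, smul_zero],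
                fun v => Submodule.smul_mem _ _ (ha.2.2 v)⟩ }, fun x => Iff.rfl⟩
  obtain ⟨Lw, hLw⟩ : ∃ Lw : Submodule ℂ (Module.End ℂ M), ∀ z, z ∈ Lw ↔ z ∈ H.hodgeLieC ∧ (∀ q ∈ Q, z q = 0) ∧ (∀ v, z v ∈ Q) := by
    refine ⟨{ carrier := {z | z ∈ H.hodgeLieC ∧ (∀ q ∈ Q, z q = 0) ∧ (∀ v, z v ∈ Q)}
              zero_mem' := ⟨Submodule.zero_mem _, fun q _ => rfl, fun v => Submodule.zero_mem _⟩
              add_mem' := fun {a b} ha hb => ⟨Submodule.add_mem _ ha.1 hb.1,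
                fun q hq => by rw [LinearMap.add_apply, ha.2.1 q hq, hb.2.1 q hq, add_zero],
                fun v => Submodule.add_mem _ (ha.2.2 v) (hb.2.2 v)⟩
              smul_mem' := fun c a ha => ⟨Submodule.smul_mem _ _ ha.1,
                fun q hq => by rw [LinearMap.smul_apply, ha.2.1 q hq, smul_zero],
                fun v => Submodule.smul_mem _ _ (ha.2.2 v)⟩ }, fun z => Iff.rfl⟩
  set G : Set (Module.End ℂ M) := {W | ∃ x ∈ H.hodgeLieC, ∃ z ∈ H.hodgeLieC,
      (∀ p ∈ P, x p = 0) ∧ (∀ v, x v ∈ P) ∧ (∀ q ∈ Q, z q = 0) ∧ (∀ v, z v ∈ Q) ∧ W = x * z - z * x} with hGdef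
  set Br : Submodule ℂ (Module.End ℂ M) := Submodule.span ℂ G with hBrdef
  have hgen : ∀ x ∈ R, ∀ z ∈ Lw, x * z - z * x ∈ Br := fun x hx z hz => by
    obtain ⟨hx𝔥, hxP, hxim⟩ := (hR x).1 hx
    obtain ⟨hz𝔥, hzQ, hzim⟩ := (hLw z).1 hz
    exact Submodule.subset_span ⟨x, hx𝔥, z, hz𝔥, hxP, hxim, hzQ, hzim, rfl⟩
  -- elements of `Br` are Levi elements of `𝔥_ℂ`
  have hBrLevi : ∀ w ∈ Br, w ∈ H.hodgeLieC ∧ (∀ p ∈ P, w p ∈ P) ∧ (∀ q ∈ Q, w q ∈ Q) := by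
    intro w hw
    induction hw using Submodule.span_induction with
    | mem w hw =>
      obtain ⟨x, hx, z, hz, hxP, hxim, hzQ, hzim, rfl⟩ := hw
      exact ⟨hbrC x hx z hz, (hRLw x z hxP hxim hzQ hzim).1, (hRLw x z hxP hxim hzQ hzim).2⟩
    | zero => exact ⟨Submodule.zero_mem _, fun p _ => by rw [LinearMap.zero_apply]; exact Submodule.zero_mem _,
        fun q _ => by rw [LinearMap.zero_apply]; exact Submodule.zero_mem _⟩
    | add w w' _ _ h h' => exact ⟨Submodule.add_mem _ h.1 h'.1, fun p hp => Submodule.add_mem _ (h.2.1 p hp) (h'.2.1 p hp),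
        fun q hq => Submodule.add_mem _ (h.2.2 q hq) (h'.2.2 q hq)⟩
    | smul c w _ h => exact ⟨Submodule.smul_mem _ _ h.1, fun p hp => Submodule.smul_mem _ _ (h.2.1 p hp),
        fun q hq => Submodule.smul_mem _ _ (h.2.2 q hq)⟩
  -- the subspace `S = R ⊔ Lw ⊔ Br`
  set S : Submodule ℂ (Module.End ℂ M) := R ⊔ Lw ⊔ Br with hSdef
  have hRle : R ≤ H.hodgeLieC := fun x hx => ((hR x).1 hx).1
  have hLwle : Lw ≤ H.hodgeLieC := fun z hz => ((hLw z).1 hz).1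
  have hBrle : Br ≤ H.hodgeLieC := fun w hw => (hBrLevi w hw).1
  have hSle : S ≤ H.hodgeLieC := sup_le (sup_le hRle hLwle) hBrle
  have hRS : R ≤ S := le_sup_left.trans le_sup_left
  have hLwS : Lw ≤ S := le_sup_right.trans le_sup_left
  have hBrS : Br ≤ S := le_sup_right
  have hSne : S ≠ ⊥ := fun h => hB0 (by
    have hm : B ∈ S := hRS ((hR B).2 ⟨hB, hBP, hBim⟩)
    rw [h, Submodule.mem_bot] at hm
    exact hm)
  -- `ad`-stability of `S`
  have hadR : ∀ Y ∈ H.hodgeLieC, ∀ x ∈ R, Y * x - x * Y ∈ S := by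
    intro Y hY x hx
    obtain ⟨hx𝔥, hxP, hxim⟩ := (hR x).1 hx
    obtain ⟨Ym, hYm, Y0, hY0, Yp, hYp, hYsum, hYpP, hYpim, hYmQ, hYmim, -, -, hY0P, hY0Q⟩ := hdec Y hY
    have h1 : Yp * x - x * Yp = 0 := by rw [hRR Yp x hYpP hxim, hRR x Yp hxP hYpim, sub_zero]
    have h2 : Y0 * x - x * Y0 ∈ R := (hR _).2 ⟨hbrC Y0 hY0 x hx𝔥, (hLR Y0 x hY0P hxP hxim).1, (hLR Y0 x hY0P hxP hxim).2⟩
    have h3 : Ym * x - x * Ym ∈ Br := by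
      have h := hgen x hx Ym ((hLw Ym).2 ⟨hYm, hYmQ, hYmim⟩)
      have e : Ym * x - x * Ym = -(x * Ym - Ym * x) := by abel
      rw [e]
      exact Submodule.neg_mem _ h
    have e : Y * x - x * Y = (Ym * x - x * Ym) + (Y0 * x - x * Y0) + (Yp * x - x * Yp) := by
      rw [hYsum]; simp only [add_mul, mul_add]; abel
    rw [e, h1, add_zero]
    exact Submodule.add_mem _ (hBrS h3) (hRS h2)
  have hadLw : ∀ Y ∈ H.hodgeLieC, ∀ z ∈ Lw, Y * z - z * Y ∈ S := by
    intro Y hY z hz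
    obtain ⟨hz𝔥, hzQ, hzim⟩ := (hLw z).1 hz
    obtain ⟨Ym, hYm, Y0, hY0, Yp, hYp, hYsum, hYpP, hYpim, hYmQ, hYmim, -, -, hY0P, hY0Q⟩ := hdec Y hY
    have h1 : Ym * z - z * Ym = 0 := by rw [hLL Ym z hYmQ hzim, hLL z Ym hzQ hYmim, sub_zero]
    have h2 : Y0 * z - z * Y0 ∈ Lw := (hLw _).2 ⟨hbrC Y0 hY0 z hz𝔥, (hLLw Y0 z hY0Q hzQ hzim).1, (hLLw Y0 z hY0Q hzQ hzim).2⟩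
    have h3 : Yp * z - z * Yp ∈ Br := hgen Yp ((hR Yp).2 ⟨hYp, hYpP, hYpim⟩) z hz
    have e : Y * z - z * Y = (Ym * z - z * Ym) + (Y0 * z - z * Y0) + (Yp * z - z * Yp) := by
      rw [hYsum]; simp only [add_mul, mul_add]; abel
    rw [e, h1, zero_add]
    exact Submodule.add_mem _ (hLwS h2) (hBrS h3)
  have hadG : ∀ Y ∈ H.hodgeLieC, ∀ w ∈ G, Y * w - w * Y ∈ S := by
    intro Y hY w hw
    obtain ⟨x, hx𝔥, z, hz𝔥, hxP, hxim, hzQ, hzim, rfl⟩ := hw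
    have hx : x ∈ R := (hR x).2 ⟨hx𝔥, hxP, hxim⟩
    have hz : z ∈ Lw := (hLw z).2 ⟨hz𝔥, hzQ, hzim⟩
    obtain ⟨Ym, hYm, Y0, hY0, Yp, hYp, hYsum, hYpP, hYpim, hYmQ, hYmim, -, -, hY0P, hY0Q⟩ := hdec Y hY
    -- the six pieces
    have hr1 : Y0 * x - x * Y0 ∈ R := (hR _).2 ⟨hbrC Y0 hY0 x hx𝔥, (hLR Y0 x hY0P hxP hxim).1, (hLR Y0 x hY0P hxP hxim).2⟩
    have hl1 : Y0 * z - z * Y0 ∈ Lw := (hLw _).2 ⟨hbrC Y0 hY0 z hz𝔥, (hLLw Y0 z hY0Q hzQ hzim).1, (hLLw Y0 z hY0Q hzQ hzim).2⟩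
    have hβ1 := hRLw x Ym hxP hxim hYmQ hYmim   -- `[x, Ym]` is Levi
    have hβ2 := hRLw Yp z hYpP hYpim hzQ hzim   -- `[Yp, z]` is Levi
    have t1 : (Y0 * x - x * Y0) * z - z * (Y0 * x - x * Y0) ∈ Br := hgen _ hr1 z hz
    have t2 : x * (Y0 * z - z * Y0) - (Y0 * z - z * Y0) * x ∈ Br := hgen x hx _ hl1
    have t3 : (Ym * x - x * Ym) * z - z * (Ym * x - x * Ym) ∈ Lw := by
      have hL : ∀ q ∈ Q, (Ym * x - x * Ym) q ∈ Q := fun q hq => by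
        have h := hβ1.2 q hq
        have e : (Ym * x - x * Ym) q = -((x * Ym - Ym * x) q) := by simp only [LinearMap.sub_apply]; abel
        rw [e]; exact Submodule.neg_mem _ h
      refine (hLw _).2 ⟨hbrC _ (hbrC Ym hYm x hx𝔥) z hz𝔥, (hLLw _ z hL hzQ hzim).1, (hLLw _ z hL hzQ hzim).2⟩
    have t4 : x * (Yp * z - z * Yp) - (Yp * z - z * Yp) * x ∈ R := by
      have hL : ∀ p ∈ P, (Yp * z - z * Yp) p ∈ P := hβ2.1
      have h := hLR _ x hL hxP hxim
      have e : x * (Yp * z - z * Yp) - (Yp * z - z * Yp) * x = -((Yp * z - z * Yp) * x - x * (Yp * z - z * Yp)) := by abel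
      rw [e]
      exact Submodule.neg_mem _ ((hR _).2 ⟨hbrC _ (hbrC Yp hYp z hz𝔥) x hx𝔥, h.1, h.2⟩)
    have t5 : (Yp * x - x * Yp) * z - z * (Yp * x - x * Yp) = 0 := by
      rw [hRR Yp x hYpP hxim, hRR x Yp hxP hYpim, sub_zero, zero_mul, mul_zero, sub_zero]
    have t6 : x * (Ym * z - z * Ym) - (Ym * z - z * Ym) * x = 0 := by
      rw [hLL Ym z hYmQ hzim, hLL z Ym hzQ hYmim, sub_zero, zero_mul, mul_zero, sub_zero]
    -- Jacobi
    have e : Y * (x * z - z * x) - (x * z - z * x) * Y =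
        ((Ym * x - x * Ym) * z - z * (Ym * x - x * Ym)) + (x * (Ym * z - z * Ym) - (Ym * z - z * Ym) * x) +
        (((Y0 * x - x * Y0) * z - z * (Y0 * x - x * Y0)) + (x * (Y0 * z - z * Y0) - (Y0 * z - z * Y0) * x)) +
        (((Yp * x - x * Yp) * z - z * (Yp * x - x * Yp)) + (x * (Yp * z - z * Yp) - (Yp * z - z * Yp) * x)) := by
      rw [hYsum]; simp only [add_mul, mul_add, sub_mul, mul_sub, mul_assoc]; abel
    rw [e, t5, t6, add_zero, zero_add]
    exact Submodule.add_mem _ (Submodule.add_mem _ (hLwS t3) (Submodule.add_mem _ (hBrS t1) (hBrS t2))) (hRS t4)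
  have hadBr : ∀ Y ∈ H.hodgeLieC, ∀ w ∈ Br, Y * w - w * Y ∈ S := by
    intro Y hY w hw
    induction hw using Submodule.span_induction with
    | mem w hw => exact hadG Y hY w hw
    | zero => rw [mul_zero, zero_mul, sub_zero]; exact Submodule.zero_mem _
    | add w w' _ _ h h' =>
      have e : Y * (w + w') - (w + w') * Y = (Y * w - w * Y) + (Y * w' - w' * Y) := by rw [mul_add, add_mul]; abel
      rw [e]; exact Submodule.add_mem _ h h'
    | smul c w _ h =>
      have e : Y * (c • w) - (c • w) * Y = c • (Y * w - w * Y) := by rw [mul_smul_comm, smul_mul_assoc, smul_sub]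
      rw [e]; exact Submodule.smul_mem _ _ h
  have hadS : ∀ Y ∈ H.hodgeLieC, ∀ s ∈ S, Y * s - s * Y ∈ S := by
    intro Y hY s hs
    obtain ⟨rl, hrl, w, hw, rfl⟩ := Submodule.mem_sup.1 hs
    obtain ⟨x, hx, z, hz, rfl⟩ := Submodule.mem_sup.1 hrl
    have e : Y * (x + z + w) - (x + z + w) * Y = (Y * x - x * Y) + (Y * z - z * Y) + (Y * w - w * Y) := by
      simp only [mul_add, add_mul]; abel
    rw [e]
    exact Submodule.add_mem _ (Submodule.add_mem _ (hadR Y hY x hx) (hadLw Y hY z hz)) (hadBr Y hY w hw)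
  have hStop : S = H.hodgeLieC := hsimple S hSle hSne hadS
  -- a Levi element has no raising / lowering components
  have hZS : Z ∈ S := by rw [hStop]; exact hZ
  obtain ⟨rl, hrl, w, hw, hZeq⟩ := Submodule.mem_sup.1 hZS
  obtain ⟨x, hx, z, hz, rfl⟩ := Submodule.mem_sup.1 hrl
  obtain ⟨-, hxP, hxim⟩ := (hR x).1 hx
  obtain ⟨-, hzQ, hzim⟩ := (hLw z).1 hz
  obtain ⟨-, hwP, hwQ⟩ := hBrLevi w hw
  -- `x = 0` and `z = 0`
  have hz0 : z = 0 := by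
    refine LinearMap.ext fun v => ?_
    rw [LinearMap.zero_apply, ← hPQv v, map_add, hzQ _ (hQmem v), add_zero]
    -- `z p = Z p - x p - w p ∈ P ∩ Q`
    have hp := hPmem v
    have h1 : z ((2 : ℂ)⁻¹ • (v + Θ v)) = Z ((2 : ℂ)⁻¹ • (v + Θ v)) - w ((2 : ℂ)⁻¹ • (v + Θ v)) := by
      rw [← hZeq, LinearMap.add_apply, LinearMap.add_apply, hxP _ hp, zero_add, add_sub_cancel_right]
    refine hPQ0 _ ?_ (hzim _)
    rw [h1]
    exact Submodule.sub_mem _ (hZP _ hp) (hwP _ hp)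
  have hx0 : x = 0 := by
    refine LinearMap.ext fun v => ?_
    rw [LinearMap.zero_apply, ← hPQv v, map_add, hxP _ (hPmem v), zero_add]
    have hq := hQmem v
    have h1 : x ((2 : ℂ)⁻¹ • (v - Θ v)) = Z ((2 : ℂ)⁻¹ • (v - Θ v)) - w ((2 : ℂ)⁻¹ • (v - Θ v)) := by
      rw [← hZeq, LinearMap.add_apply, LinearMap.add_apply, hzQ _ hq, add_zero, add_sub_cancel_right]
    refine hPQ0 _ (hxim _) ?_
    rw [h1]
    exact Submodule.sub_mem _ (hZQ _ hq) (hwQ _ hq)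
  rw [hx0, hz0, zero_add, zero_add] at hZeq
  rw [← hZeq]
  exact hw

end HodgeStructure

end Literature.AlgebraicGeometry.Motives
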